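import Literature.Topology.FourManifolds.HCobordismSlideStepTopDisc
import Literature.AlgebraicTopology.SingularHomology.TransverseDiscFunctionalLocalisation
import Literature.AlgebraicTopology.SingularHomology.ReflectedChartSign
import HarnessLib

/-!
# Milnor 1965, proof of Thm. 7.6 (PDF p. 52): the signature of one outcome of the slide

Topic `Literature/Topology/FourManifolds`; sequel to `HCobordismSlideStepCrossingValue.lean` and
`HCobordismSlideStepTopDisc.lean` for the named fact
`Literature.Topology.FourManifolds.Cobordism.Milnor1965_basisTheorem_slab` (Milnor, *Lectures on
the h-cobordism theorem* (1965), Thm. 7.6 on a slab), of which only the hypothesis `HSgn` of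
`Cobordism.Milnor1965_basisTheorem_slab_of_crossingSign` (*"with intersection number
`D_R(p₂) · D_L'(p₁) = +1`"* — the sign being the choice of the frame `μ(b)` of Lemma 7.7, i.e. of
the docking `ρ`) remains.  The tree proves `HSgn` by comparing the outcomes of the slide for two
mirror-image dockings; this file extracts from ONE outcome everything the comparison needs, in
terms of data shared by all outcomes (**`SlideSetting.slideSignature`**).  Fix the slab flow `θ`
of `(g₁, ξ)` on the band, the flow-regular transverse disc datum `Tⱼ` of `D_R(σ j)` with its
normal coordinate `K̃` (`Cobordism.exists_flowRegular_transverseDiscDatum`), the derivative `X'`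
of the sheet coordinate (`SlideSetting.exists_hasFDerivAt_sheetCoord`), the linear map
`L₀ = D(K̃ ∘ ι ∘ ψ_R)(2, 0, 0) ∘ (a, X' x, 0)`, a level `a_L ∈ [t₂', c₁)`, the open `k`-cell
`O = {y ∈ W^s_ξ(σ i) | a_L < g₁ y}` (`SlideSetting.exists_homeomorph_topDisc`) with a
`ℤ`-orientation `μ`, and any transverse disc datum `Tᵢ` of `D_R(σ i)`.  Then for the outcome of
`SlideSetting.exists_slidePair ρ` and a generator `γ` of `H_k(D_L'(σ i), S_L'(σ i))`, with
`x'` its class in `H_k(X, A)`, there are units `ε`, `η` and a chart `ê` of the strip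
`𝒱 = {a_L < a < (a_L + c₁)/2}` of `ℝᵏ` into `O` such that:

* `ê` is the flow-up of the sheet: `ê(L_k(a, x))` is the point at the level `a` of the
  `ξ`-trajectory through `ι ψ_L^ρ(0, x, 0)` (above `t₂'` the new disc is the old one and the
  crossing chart is the flow-up of the sheet, `HCobordismSlideStepTopDisc.lean`);
* `Λᵢ(x') = ε • retᵢ⁎ excᵢ⁻¹ ((O ⊆ X)⁎ μ_{σ i})` (the functional of `Tᵢ` localises at the germ
  crossing `σ i ∈ O`: `TransverseDiscDatum.functional_map_eq_of_toLocal_eq_map`, with the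
  uniform unit `ε` of `exists_units_relLocalFamily_eq_smul_map` comparing `γ|_O` with `μ`);
* `Λⱼ(x') = -(η · sign det L₀) • w₀` (the crossing formula
  `TransverseDiscDatum.functional_map_eq_smul_of_single` at the transverse crossing of
  `HCobordismSlideStepCrossingValue.lean`, whose derivative is `L₀` precomposed with the scaling
  of the `a`-coordinate by the negative derivative of the sweep profile, with the uniform
  incidence `η` of `exists_units_forall_toLocal_eq_incidence` along the crossing chart);
* along `ê`, `μ = (ε η) • ê⁎ g𝔼` (the two uniform units read at the points of the strip, where the
  crossing chart maps into `O`).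

For the mirror docking `r ≫ ρ` the chart is `ê ∘ (1 × r)` (`SlideSetting.psiL_sheet_trans`), so
the last item flips `ε η` (`units_eq_neg_of_localClass_eq_smul_of_det_neg`) while the first
two items show that `ε`, `η` carry the signs of `Λᵢ(x')`, `Λⱼ(x')`: this is how the sequel
derives `HSgn`.  Everything here is proved; no definitions, no named facts.

## References

* J. Milnor, *Lectures on the h-cobordism theorem*, notes by L. Siebenmann and J. Sondow,
  Princeton Mathematical Notes (1965): Def. 3.9 (PDF p. 16), Thm. 3.4 (PDF pp. 12–13),
  Lemma 7.7 and the proof of Thm. 7.6 (PDF pp. 50–52).  Held: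
  `lit read book:milnornd-lectures-h-cobordism-theorem`. [MilnorHCobordism1965]
* A. Hatcher, *Algebraic Topology*, CUP 2002, Thm. 2.20, §2.2 Exercise 7, §3.3 pp. 231–236.
  [HatcherAT2002]
-/

open scoped Manifold ContDiff Topology
open Set Function Filter Metric CategoryTheory OpenPartialHomeomorph
open Literature.AlgebraicTopology.SingularHomology

noncomputable section

namespace Literature.Topology.FourManifolds

universe u

variable {n : ℕ} {M N : Type u} [TopologicalSpace M] [T2Space M] [SecondCountableTopology M]
  [ChartedSpace (EuclideanSpace ℝ (Fin n)) M] [IsManifold (𝓡 n) ∞ M] [CompactSpace M]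
  [TopologicalSpace N] [T2Space N] [SecondCountableTopology N]
  [ChartedSpace (EuclideanSpace ℝ (Fin n)) N] [IsManifold (𝓡 n) ∞ N] [CompactSpace N]

namespace SlideSetting

variable {c : Cobordism n M N} {g : c.W → ℝ}
  {ξ : Cₛ^∞⟮𝓡∂ (n + 1); EuclideanSpace ℝ (Fin (n + 1)), (TangentSpace (𝓡∂ (n + 1)) : c.W → Type)⟯}
  {t₀ t₁ b : ℝ} {k a : ℕ} {σ : Fin a → c.W} {i j : Fin a}
  (S : SlideSetting c g ξ t₀ t₁ b k σ i j)

/-- Bookkeeping with units: `ε • A = B`, `B = η • C` give `A = (ε η) • C` (`ε² = 1`). [folklore] -/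
theorem _root_.Literature.Topology.FourManifolds.eq_units_mul_smul_of_smul_eq {Mod : Type*} [AddCommGroup Mod]
    (ε η : ℤˣ) {A B C : Mod} (h : (ε : ℤ) • A = B) (hB : B = (η : ℤ) • C) :
    A = ((ε * η : ℤˣ) : ℤ) • C := by
  subst hB
  have h2 : (ε : ℤ) • (ε : ℤ) • A = (ε : ℤ) • (η : ℤ) • C := congrArg (fun x => (ε : ℤ) • x) h
  rw [← mul_zsmul, ← Units.val_mul, Int.units_mul_self, Units.val_one, one_zsmul, ← mul_zsmul,
    ← Units.val_mul] at h2
  exact h2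

set_option maxHeartbeats 12000000 in
/-- **The signature of one outcome of the slide** (Milnor 1965, proof of Thm. 7.6 with Lemma 7.7,
PDF pp. 50–52; module docstring).  Hypotheses: `t₁ < 1`, a presentation `X` of the slab, a
subset `A ⊆ X`, a docking `ρ`; the shared data `θ` (slab flow of `(g₁, ξ)` on the band), `Tⱼ`
with `A ⊆ X ∖ Pⱼ`, stratum the unstable set of `σ j`, and the flow-regular normal coordinate
`K̃` on the region `R` (`Cobordism.exists_flowRegular_transverseDiscDatum`), `X'` (injective
derivative at `0` of the sheet coordinate), `L₀` (the reference crossing derivative), `Tᵢ` with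
`A ⊆ X ∖ Pᵢ` and stratum the unstable set of `σ i`; an outcome of
`SlideSetting.exists_slidePair ρ` (its full list of conclusions); an orientation `g𝔼` of `ℝᵏ`; a
level `a_L` with `c₀ ≤ a_L`, `t₂' ≤ a_L < c₁` and a `ℤ`-orientation `μ` of the open cell
`O = {y ∈ W^s_ξ(σ i) | a_L < g₁ y}`; the new disc `D_L'(σ i) ⊆ X` with its sphere in `A` and a
generator `γ` of `H_k(D_L'(σ i), S_L'(σ i); ℤ)`.  Conclusion: units `ε`, `η`, a chart `ê` of the
strip `{a_L < a < (a_L + c₁)/2}` into `O` which is the flow-up of the sheet `x ↦ ι ψ_L^ρ(0, x, 0)`,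
with `Λᵢ(x') = ε • retᵢ⁎ excᵢ⁻¹ ((O ⊆ X)⁎ μ_{σ i})`, `det L₀ ≠ 0`,
`Λⱼ(x') = -(η · sign det L₀) • w₀`, and `μ = (ε η) • ê⁎ g𝔼` along `ê`.
[cite: MilnorHCobordism1965, proof of Thm. 7.6 and Lemma 7.7 (PDF pp. 50–52), Thm. 3.4 (PDF pp. 12–13), Def. 3.9 (PDF p. 16); HatcherAT2002, Thm. 2.20, §2.2 Exercise 7, §3.3 pp. 231–236] -/
theorem slideSignature (_ht₁ : t₁ < 1) {X : Set c.W} (hX : ∀ z, z ∈ X ↔ g z ∈ Icc t₀ t₁)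
    {A : Set ↥X}
    (ρ : (EuclideanSpace ℝ (Fin (k - 1))) ≃ₗᵢ[ℝ] EuclideanSpace ℝ (Fin (k - 1)))
    {θ : ℝ × c.W → c.W} (hθ : c.SlabFlow S.g₁ (⇑ξ) S.c₀ S.c₁ θ)
    (Tj : TransverseDiscDatum ↥X k) (hAj : A ⊆ Tj.Pᶜ)
    (hPj : ∀ z : ↥X, z ∈ Tj.P ↔ (z : c.W) ∈ unstableSet (𝓡∂ (n + 1)) (⇑ξ) (σ j))
    {R : Set c.W} {Kt : c.W → EuclideanSpace ℝ (Fin k)} (hRo : IsOpen R)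
    (hKts : ContMDiffOn (𝓡∂ (n + 1)) 𝓘(ℝ, EuclideanSpace ℝ (Fin k)) ∞ Kt R)
    (hKtK : ∀ z : ↥X, (z : c.W) ∈ R → ∃ hzN : z ∈ Tj.N, Tj.K ⟨z, hzN⟩ = Kt z)
    (hKtinv : ∀ z z', z ∈ R → z' ∈ R → FlowsTo (𝓡∂ (n + 1)) (⇑ξ) z z' → Kt z = Kt z')
    (hKtrank : ∀ y ∈ unstableSet (𝓡∂ (n + 1)) (⇑ξ) (σ j), y ∈ R →
      ∃ m : EuclideanSpace ℝ (Fin k) → c.W, m 0 = y ∧ ∀ᶠ w in 𝓝 (0 : EuclideanSpace ℝ (Fin k)),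
        ContMDiffAt 𝓘(ℝ, EuclideanSpace ℝ (Fin k)) (𝓡∂ (n + 1)) ∞ m w ∧ m w ∈ R ∧ Kt (m w) = w)
    (hRmem : ∀ y ∈ unstableSet (𝓡∂ (n + 1)) (⇑ξ) (σ j), y ∉ {z : c.W | S.g₁ z < S.c₀} → g y < t₁ → y ∈ R)
    (X' : EuclideanSpace ℝ (Fin (k - 1)) →L[ℝ] EuclideanSpace ℝ (Fin (k - 1)))
    (hX'inj : Function.Injective X')
    (hXd : HasFDerivAt (fun x : EuclideanSpace ℝ (Fin (k - 1)) =>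
        (S.preB ((univBall (0 : EuclideanSpace ℝ (Fin n)) S.rA).symm
          (S.L₃.symm (((0 : ℝ), x, (0 : EuclideanSpace ℝ (Fin (n - k)))) : Model n k)))).2.1) X' 0)
    {L₀ : EuclideanSpace ℝ (Fin k) →L[ℝ] EuclideanSpace ℝ (Fin k)}
    (hL₀ : L₀ = (fderiv ℝ (fun z : Model n k => Kt (S.ι (S.psiR z)))
        (((2 : ℝ), (0 : EuclideanSpace ℝ (Fin (k - 1))), (0 : EuclideanSpace ℝ (Fin (n - k)))) : Model n k)).comp
      (((ContinuousLinearMap.fst ℝ ℝ (EuclideanSpace ℝ (Fin (k - 1)))).comp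
          (S.Lk.symm : EuclideanSpace ℝ (Fin k) →L[ℝ] ℝ × EuclideanSpace ℝ (Fin (k - 1)))).prod
        ((X'.comp ((ContinuousLinearMap.snd ℝ ℝ (EuclideanSpace ℝ (Fin (k - 1)))).comp
          (S.Lk.symm : EuclideanSpace ℝ (Fin k) →L[ℝ] ℝ × EuclideanSpace ℝ (Fin (k - 1))))).prod
          (0 : EuclideanSpace ℝ (Fin k) →L[ℝ] EuclideanSpace ℝ (Fin (n - k))))))
    (Ti : TransverseDiscDatum ↥X k) (hAi : A ⊆ Ti.Pᶜ)
    (hPi : ∀ z : ↥X, z ∈ Ti.P ↔ (z : c.W) ∈ unstableSet (𝓡∂ (n + 1)) (⇑ξ) (σ i))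
    -- the outcome of `SlideSetting.exists_slidePair ρ`
    (_f : S.V ≃ₘ⟮𝓡 n, 𝓡 n⟯ S.V) (_hfW : Diffeomorph.IsCompactlyDiffeotopicToIdIn S.W _f)
    (_hfFlat : ∀ v ∈ S.Flat, ‖v‖ ≤ 1 → _f (S.discA ρ v) = S.discB v)
    (Φ : OpenPartialHomeomorph S.V (SlideSetting.Model n k))
    (hΦsm : ContMDiffOn (𝓡 n) 𝓘(ℝ, SlideSetting.Model n k) ∞ Φ Φ.source)
    (hΦsm' : ContMDiffOn 𝓘(ℝ, SlideSetting.Model n k) (𝓡 n) ∞ Φ.symm Φ.target)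
    (hsph : ∀ z, Φ.symm z ∈ S.rightSphere S.jR ↔ z.1 = 2 ∧ z.2.1 = 0)
    (_hother : ∀ l, l ≠ S.jR → ∀ z, Φ.symm z ∉ S.rightSphere l)
    (O : Set (SlideSetting.Model n k)) (hOo : IsOpen O) (hOsub : {z | z.1 = 2 ∧ z.2.1 = 0} ⊆ O)
    (hO : ∀ z ∈ O, Φ.symm z = S.psiR z)
    (_hcentre : ∀ v : EuclideanSpace ℝ (Fin n), ‖v‖ ≤ 1 / 8 →
      S.preB v ∈ Φ.target ∧ Φ.symm (S.preB v) = S.discB v)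
    (r₀ : ℝ) (hr₀ : 0 < r₀) (hr₀sub : {z : SlideSetting.Model n k | ‖z.2.2‖ < r₀} ⊆ Φ.target)
    (δ : ℝ) (α : ℝ → ℝ) (hδ : 0 < δ) (_hαs : ContDiff ℝ ∞ α) (hαδ : ∀ u, u ≤ δ → α u = 5 / 2)
    (_hα2δ : ∀ u, 2 * δ ≤ u → α u = 1) (_hαb : ∀ u, 1 ≤ α u ∧ α u ≤ 5 / 2)
    (F : AmbientIsotopy (𝓡 n) S.V)
    (hcross : ∀ t, ∀ p ∈ S.leftSphere, ∀ l, F.toFun t p ∈ S.rightSphere l →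
      l = S.jR ∧ p = S.discA ρ 0 ∧ 1 / 2 ≤ t ∧ Real.smoothTransition (2 * t - 1) = 2 / 3)
    (hformula : ∀ t, 1 / 2 ≤ t → ∀ v ∈ S.Flat, ‖v‖ ≤ 1 / 8 →
      F.toFun t (S.discA ρ v) = Φ.symm
        ((1 + Real.smoothTransition (2 * t - 1) * (α (‖(S.preB v).2.1‖ ^ 2) - 1),
          (S.preB v).2.1, (0 : EuclideanSpace ℝ (Fin (n - k)))) : SlideSetting.Model n k))
    (_hearly : ∀ t, t ≤ 1 / 2 → ∀ p ∈ S.W, F.toFun t p ∈ S.W)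
    (_hend : F.toFun 1 '' S.leftSphere ⊆ S.W)
    (ξ₃ : Cₛ^∞⟮𝓡∂ (n + 1); EuclideanSpace ℝ (Fin (n + 1)), (TangentSpace (𝓡∂ (n + 1)) : c.W → Type)⟯)
    (hξ₃ : IsGradientLike (𝓡∂ (n + 1)) S.g₁ ξ₃)
    (hξ₃eq : ∀ z, S.g₁ z ∉ Ioo S.c₀ S.c₁ → ξ₃ z = ξ z)
    (_hpush : ∀ x, S.g₁ x = S.c₁ → ∀ v : S.V, FlowsTo (𝓡∂ (n + 1)) ξ (S.ι v) x →
      FlowsTo (𝓡∂ (n + 1)) ξ₃ (S.ι (F.toFun 1 v)) x)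
    (_hpull : ∀ x, S.g₁ x = S.c₁ → ∀ v : S.V, FlowsTo (𝓡∂ (n + 1)) ξ₃ (S.ι v) x →
      ∃ v₀ : S.V, F.toFun 1 v₀ = v ∧ FlowsTo (𝓡∂ (n + 1)) ξ (S.ι v₀) x)
    (ν : ℝ → ℝ) (hνc : Continuous ν) (_hν0 : ν S.c₀ = 1) (_hν1 : ν S.c₁ = 0)
    (_hν01 : ∀ t, 0 ≤ ν t ∧ ν t ≤ 1)
    (t₁' t₂' : ℝ) (h01' : S.c₀ < t₁') (h12 : t₁' < t₂') (h2c : t₂' < S.c₁)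
    (hνt : ∀ t, ν t = Real.smoothTransition ((t₂' - t) / (t₂' - t₁')))
    (htrack : ∀ q : S.V, ∀ τ ∈ Icc 0 (S.c₁ - S.c₀), ∃ y : c.W, S.g₁ y = S.c₀ + τ ∧
      FlowsTo (𝓡∂ (n + 1)) ξ (S.ι (F.toFun (ν (S.c₀ + τ)) q)) y ∧
      FlowsTo (𝓡∂ (n + 1)) ξ₃ (S.ι (F.toFun 1 q)) y)
    (hleft : leftHandSphere (𝓡∂ (n + 1)) S.g₁ ξ₃ (σ i) S.c₀ = S.ι '' (F.toFun 1 '' S.leftSphere))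
    (_hright : ∀ l : {l : Fin a // l ≠ i},
      rightHandSphere (𝓡∂ (n + 1)) S.g₁ ξ₃ (σ l) S.c₀ = S.ι '' S.rightSphere l)
    (_hdisj : ∀ l : {l : Fin a // l ≠ i},
      Disjoint (trajectorySet (𝓡∂ (n + 1)) ξ₃ (σ l)) (trajectorySet (𝓡∂ (n + 1)) ξ₃ (σ i)))
    (g' : c.W → ℝ) (hg' : c.IsMorseFunction g') (hξg' : IsGradientLike (𝓡∂ (n + 1)) g' ξ₃)
    (hcrit' : criticalSet (𝓡∂ (n + 1)) g' = criticalSet (𝓡∂ (n + 1)) g)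
    (hind : ∀ z ∈ criticalSet (𝓡∂ (n + 1)) g, morseIndex (𝓡∂ (n + 1)) g' z = morseIndex (𝓡∂ (n + 1)) g z)
    (hval : ∀ l, g' (σ l) = b)
    (_hnear : ∀ᶠ z in 𝓝ˢ {z | S.g₁ z ∉ Ioo S.u S.v}, g' z = S.g₁ z)
    (hIoo : ∀ z, S.g₁ z ∈ Ioo S.u S.v → g' z ∈ Ioo S.u S.v)
    (halt : ∀ z, g z ∉ Ioo S.u S.v → g' z = g z)
    (_halt' : ∀ z, g z ∈ Ioo S.u S.v → g' z ∈ Ioo S.u S.v)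
    (_hlocI : ∀ᶠ z in 𝓝 (σ i), g' z = S.g₁ z + (b - S.bP))
    (_hlocO : ∀ l, l ≠ i → ∀ᶠ z in 𝓝 (σ l), g' z = S.g₁ z)
    (g𝔼 : HomologicalOrientation ℤ (EuclideanSpace ℝ (Fin k)) k)
    -- the level and the orientation of the top disc
    {aL : ℝ} (hc₀aL : S.c₀ ≤ aL) (haL : t₂' ≤ aL) (haL₁ : aL < S.c₁)
    (μ : HomologicalOrientation ℤ {y : c.W // y ∈ stableSet (𝓡∂ (n + 1)) (⇑ξ) (σ i) ∧ aL < S.g₁ y} k)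
    -- the generator of the new disc
    (h₁' : leftHandDisc (𝓡∂ (n + 1)) g' ξ₃ (σ i) t₀ ⊆ X)
    (h₀' : MapsTo (Set.inclusion h₁')
      (Subtype.val ⁻¹' leftHandSphere (𝓡∂ (n + 1)) g' ξ₃ (σ i) t₀) A)
    (γ₀ : relativeSingularHomology ℤ ℤ ↥(leftHandDisc (𝓡∂ (n + 1)) g' ξ₃ (σ i) t₀)
      (Subtype.val ⁻¹' leftHandSphere (𝓡∂ (n + 1)) g' ξ₃ (σ i) t₀) k)
    (hγ₀ : ∃ φ : _ ≃ₗ[ℤ] ℤ, φ γ₀ = 1) :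
    ∃ (ε η : ℤˣ)
      (hmaps : MapsTo (fun o : {y : c.W // y ∈ stableSet (𝓡∂ (n + 1)) (⇑ξ) (σ i) ∧ aL < S.g₁ y} =>
          (⟨(o : c.W), S.mem_slab_of_mem_topDisc hX hc₀aL o.2⟩ : ↥X))
        ({⟨σ i, S.σi_mem_topDisc haL₁⟩}ᶜ : Set {y : c.W // y ∈ stableSet (𝓡∂ (n + 1)) (⇑ξ) (σ i) ∧ aL < S.g₁ y})
        Ti.Pᶜ)
      (W : Set {y : c.W // y ∈ stableSet (𝓡∂ (n + 1)) (⇑ξ) (σ i) ∧ aL < S.g₁ y})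
      (ê : ↥{p : EuclideanSpace ℝ (Fin k) | aL < (S.Lk.symm p).1 ∧ (S.Lk.symm p).1 < (aL + S.c₁) / 2} ≃ₜ ↥W),
      (∀ v, (((ê v : ↥W) : {y : c.W // y ∈ stableSet (𝓡∂ (n + 1)) (⇑ξ) (σ i) ∧ aL < S.g₁ y}) : c.W) =
        Flow.levelProj θ S.g₁ (S.Lk.symm (v : EuclideanSpace ℝ (Fin k))).1
          (S.ι (S.psiL ρ (((0 : ℝ), (S.Lk.symm (v : EuclideanSpace ℝ (Fin k))).2,
            (0 : EuclideanSpace ℝ (Fin (n - k)))) : Model n k)))) ∧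
      Ti.functional hAi k ((relativeSingularHomology.map ℤ ℤ
          (⟨Set.inclusion h₁', continuous_inclusion h₁'⟩ :
            C(↥(leftHandDisc (𝓡∂ (n + 1)) g' ξ₃ (σ i) t₀), ↥X)) h₀' k).hom γ₀) =
        (ε : ℤ) • relativeSingularHomology.map ℤ ℤ Ti.ret Ti.mapsTo_ret k
          (inv (Ti.exc k) (relativeSingularHomology.map ℤ ℤ
            (⟨fun o : {y : c.W // y ∈ stableSet (𝓡∂ (n + 1)) (⇑ξ) (σ i) ∧ aL < S.g₁ y} =>
                (⟨(o : c.W), S.mem_slab_of_mem_topDisc hX hc₀aL o.2⟩ : ↥X),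
              continuous_subtype_val.subtype_mk _⟩ : C(_, ↥X)) hmaps k
            (μ.localClass ⟨σ i, S.σi_mem_topDisc haL₁⟩))) ∧
      LinearMap.det (L₀ : EuclideanSpace ℝ (Fin k) →ₗ[ℝ] EuclideanSpace ℝ (Fin k)) ≠ 0 ∧
      Tj.functional hAj k ((relativeSingularHomology.map ℤ ℤ
          (⟨Set.inclusion h₁', continuous_inclusion h₁'⟩ :
            C(↥(leftHandDisc (𝓡∂ (n + 1)) g' ξ₃ (σ i) t₀), ↥X)) h₀' k).hom γ₀) =
        (-((η : ℤ) * (SignType.sign (LinearMap.det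
          (L₀ : EuclideanSpace ℝ (Fin k) →ₗ[ℝ] EuclideanSpace ℝ (Fin k))) : ℤ))) • Tj.baseClass g𝔼 ∧
      ∀ c' : ↥{p : EuclideanSpace ℝ (Fin k) | aL < (S.Lk.symm p).1 ∧ (S.Lk.symm p).1 < (aL + S.c₁) / 2},
        μ.localClass ((ê c' : ↥W) : {y : c.W // y ∈ stableSet (𝓡∂ (n + 1)) (⇑ξ) (σ i) ∧ aL < S.g₁ y}) =
          ((ε * η : ℤˣ) : ℤ) • relativeSingularHomology.map ℤ ℤ (subsetIncl W)
            (localHomology.mapsTo_subsetIncl_compl (ê c').2) k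
            (localHomology.xEquiv ℤ ℤ ê c' k
              ((localHomology.openSubsetIso ℤ ℤ (S.isOpen_levelStrip aL ((aL + S.c₁) / 2)) c'.2 k).inv
                (g𝔼.localClass (c' : EuclideanSpace ℝ (Fin k))))) := by
  have hc₀aL' : S.c₀ < aL := (h01'.trans h12).trans_le haL
  have hatop : t₂' ≤ (aL + S.c₁) / 2 := by linarith
  have hatop' : (aL + S.c₁) / 2 < S.c₁ := by linarith
  ----------------------------------------------------------------------------------------------
  -- Step 0: bookkeeping
  ----------------------------------------------------------------------------------------------
  have hreg := S.band_regular
  have hIcc0 : S.c₀ ∈ Icc S.c₀ S.c₁ := left_mem_Icc.2 S.hc₀c₁.le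
  haveI : Nonempty S.V := ⟨S.discA ρ 0⟩
  have hνfun : ν = fun t => Real.smoothTransition ((t₂' - t) / (t₂' - t₁')) := funext hνt
  have hνs : ContDiff ℝ ∞ ν := by
    rw [hνfun]
    exact Real.smoothTransition.contDiff.comp ((contDiff_const.sub contDiff_id).div_const _)
  -- membership in the slab `X` and in the open slab `(u, v)` of points of the band
  have hband_uv : ∀ y : c.W, S.c₀ ≤ S.g₁ y → S.g₁ y < S.c₁ → S.g₁ y ∈ Ioo S.u S.v := fun y hy0 hy1 =>
    ⟨S.huc₀.trans_le hy0, hy1.trans (S.hc₁bP.trans S.hbPv)⟩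
  have hband_X : ∀ y : c.W, S.c₀ ≤ S.g₁ y → S.g₁ y < S.c₁ → y ∈ X := fun y hy0 hy1 =>
    (hX y).2 (Ioo_subset_Icc_self (S.Ioo_uv_subset (S.apply_mem_Ioo_of_apply₁_mem_Ioo (hband_uv y hy0 hy1))))
  ----------------------------------------------------------------------------------------------
  -- Step 1: the crossing chart (reaching the level `t₂'`)
  ----------------------------------------------------------------------------------------------
  obtain ⟨Vk, pstar, E, hE, hVko, hpstar, hEs, hemb, hopen, hstar, huniq, ⟨alo, ahi, halo, hahi, hVk⟩,
      hEp, hx0, ha2, hνhalf, hlam⟩ :=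
    S.exists_crossingChart ρ hsph hδ hαδ hξ₃ hξ₃eq hcross hformula hνs h01' h12 h2c hνt htrack hleft
      hIoo hatop hatop'
  set astar : ℝ := (S.Lk.symm pstar).1 with hastar
  obtain ⟨hgstar, hastarI, hflowstar⟩ := hEp pstar hpstar
  rw [hx0] at hflowstar
  have hystarIoo : S.g₁ (E pstar) ∈ Ioo S.c₀ S.c₁ := by rw [hgstar]; exact hastarI
  -- the model point of the crossing on the level, `z⋆ = (2, 0, 0)`, and `Φ⁻¹ z⋆ ∈ S_R(σ j)`
  set zstar : SlideSetting.Model n k :=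
    ((2 : ℝ), (0 : EuclideanSpace ℝ (Fin (k - 1))), (0 : EuclideanSpace ℝ (Fin (n - k)))) with hzstar
  have hzstar_tgt : zstar ∈ Φ.target := hr₀sub (by show ‖(0 : EuclideanSpace ℝ (Fin (n - k)))‖ < r₀; rw [norm_zero]; exact hr₀)
  have hqV_src : Φ.symm zstar ∈ Φ.source := Φ.map_target hzstar_tgt
  have hFstar : F.toFun (ν astar) (S.discA ρ 0) = Φ.symm zstar := by
    rw [hformula (ν astar) hνhalf 0 S.Flat.zero_mem (by rw [norm_zero]; norm_num), S.preB_zero]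
    congr 1
    refine Prod.ext ?_ (Prod.ext rfl rfl)
    show 1 + Real.smoothTransition (2 * ν astar - 1) *
      (α (‖(0 : EuclideanSpace ℝ (Fin (k - 1)))‖ ^ 2) - 1) = 2
    rw [norm_zero, zero_pow two_ne_zero, hαδ 0 hδ.le, hlam]
    norm_num
  have hflow0 : FlowsTo (𝓡∂ (n + 1)) ξ (S.ι (Φ.symm zstar)) (E pstar) := by
    rw [← hFstar, ← S.psiL_sheet_zero ρ]; exact hflowstar
  -- points `ι(Φ⁻¹(2, 0, y))` lie on `S_R(σ j)`, hence on `W^u_ξ(σ j)`, on the level `c₀`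
  have hsphere : ∀ y : EuclideanSpace ℝ (Fin (n - k)),
      S.ι (Φ.symm (((2 : ℝ), (0 : EuclideanSpace ℝ (Fin (k - 1))), y) : SlideSetting.Model n k)) ∈
        unstableSet (𝓡∂ (n + 1)) ξ (σ j) := by
    intro y
    have h1 : Φ.symm (((2 : ℝ), (0 : EuclideanSpace ℝ (Fin (k - 1))), y) : SlideSetting.Model n k) ∈
        S.rightSphere S.jR := (hsph _).2 ⟨rfl, rfl⟩
    have h2 : S.ι (Φ.symm (((2 : ℝ), (0 : EuclideanSpace ℝ (Fin (k - 1))), y) : SlideSetting.Model n k)) ∈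
        rightHandSphere (𝓡∂ (n + 1)) S.g₁ ξ (σ j) S.c₀ := by
      rw [show σ j = σ (S.jR : Fin a) from rfl, ← S.image_rightSphere S.jR]
      exact ⟨_, h1, rfl⟩
    exact rightHandSphere_subset_unstableSet h2
  ----------------------------------------------------------------------------------------------
  -- Step 2: the flow-regular datum of `D_R(σ j)`, its box inside `{g₁ < c₀}`
  ----------------------------------------------------------------------------------------------
  -- the region `R` contains `W^u_ξ(σ j) ∩ {c₀ ≤ g₁ < c₁}`
  have hRmem' : ∀ y ∈ unstableSet (𝓡∂ (n + 1)) (⇑ξ) (σ j), S.c₀ ≤ S.g₁ y → S.g₁ y < S.c₁ → y ∈ R := by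
    intro y hyu hy0 hy1
    refine hRmem y hyu (fun h => (not_lt.2 hy0) h) ?_
    exact (S.apply_mem_Ioo_of_apply₁_mem_Ioo (hband_uv y hy0 hy1)).2.trans S.hvt₁
  have hystarR : E pstar ∈ R := hRmem' _ hstar hystarIoo.1.le hystarIoo.2
  have hy₀R : ∀ y : EuclideanSpace ℝ (Fin (n - k)),
      S.ι (Φ.symm (((2 : ℝ), (0 : EuclideanSpace ℝ (Fin (k - 1))), y) : SlideSetting.Model n k)) ∈ R :=
    fun y => hRmem' _ (hsphere y) (by rw [S.apply_ι]) (by rw [S.apply_ι]; exact S.hc₀c₁)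
  -- `K̃ = 0` at these points
  have hKt0 : ∀ y : EuclideanSpace ℝ (Fin (n - k)),
      Kt (S.ι (Φ.symm (((2 : ℝ), (0 : EuclideanSpace ℝ (Fin (k - 1))), y) : SlideSetting.Model n k))) = 0 := by
    intro y
    have hXmem : S.ι (Φ.symm (((2 : ℝ), (0 : EuclideanSpace ℝ (Fin (k - 1))), y) : SlideSetting.Model n k)) ∈ X :=
      hband_X _ (by rw [S.apply_ι]) (by rw [S.apply_ι]; exact S.hc₀c₁)
    obtain ⟨hN, hK⟩ := hKtK ⟨_, hXmem⟩ (hy₀R y)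
    rw [← hK]
    exact (Tj.eq_zero_iff _).2 ((hPj _).2 (hsphere y))
  ----------------------------------------------------------------------------------------------
  -- Step 3: the map `G = K̃ ∘ ι ∘ Φ⁻¹` near `z⋆`, its derivative, and its vanishing directions
  ----------------------------------------------------------------------------------------------
  have hGsmooth : ContMDiffAt 𝓘(ℝ, SlideSetting.Model n k) 𝓘(ℝ, EuclideanSpace ℝ (Fin k)) ∞
      (fun z : SlideSetting.Model n k => Kt (S.ι (Φ.symm z))) zstar := by
    have h1 : ContMDiffAt 𝓘(ℝ, SlideSetting.Model n k) (𝓡 n) ∞ Φ.symm zstar :=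
      hΦsm'.contMDiffAt (Φ.open_target.mem_nhds hzstar_tgt)
    have h2 : ContMDiffAt (𝓡 n) (𝓡∂ (n + 1)) ∞ S.ι (Φ.symm zstar) := S.hι.contMDiff _
    have h3 : ContMDiffAt (𝓡∂ (n + 1)) 𝓘(ℝ, EuclideanSpace ℝ (Fin k)) ∞ Kt (S.ι (Φ.symm zstar)) :=
      hKts.contMDiffAt (hRo.mem_nhds (hy₀R 0))
    exact h3.comp zstar (h2.comp zstar h1)
  have hGd : HasFDerivAt (fun z : SlideSetting.Model n k => Kt (S.ι (Φ.symm z)))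
      (fderiv ℝ (fun z : SlideSetting.Model n k => Kt (S.ι (Φ.symm z))) zstar) zstar :=
    ((contMDiffAt_iff_contDiffAt.1 hGsmooth).differentiableAt (by simp)).hasFDerivAt
  set G' := fderiv ℝ (fun z : SlideSetting.Model n k => Kt (S.ι (Φ.symm z))) zstar with hG'
  -- `G` vanishes on `{(2, 0, y)}`, so `G'` kills the `y`-directions
  have hY : ∀ y : EuclideanSpace ℝ (Fin (n - k)), G' ((0 : ℝ), (0 : EuclideanSpace ℝ (Fin (k - 1))), y) = 0 := by
    have haff : HasFDerivAt (fun y : EuclideanSpace ℝ (Fin (n - k)) =>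
        (((2 : ℝ), (0 : EuclideanSpace ℝ (Fin (k - 1))), y) : SlideSetting.Model n k))
        ((0 : EuclideanSpace ℝ (Fin (n - k)) →L[ℝ] ℝ).prod
          ((0 : EuclideanSpace ℝ (Fin (n - k)) →L[ℝ] EuclideanSpace ℝ (Fin (k - 1))).prod
            (ContinuousLinearMap.id ℝ (EuclideanSpace ℝ (Fin (n - k)))))) 0 :=
      (hasFDerivAt_const _ _).prodMk ((hasFDerivAt_const _ _).prodMk (hasFDerivAt_id _))
    have hcomp := hGd.comp (0 : EuclideanSpace ℝ (Fin (n - k))) haff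
    have hzero : HasFDerivAt ((fun z : SlideSetting.Model n k => Kt (S.ι (Φ.symm z))) ∘
        fun y : EuclideanSpace ℝ (Fin (n - k)) =>
          (((2 : ℝ), (0 : EuclideanSpace ℝ (Fin (k - 1))), y) : SlideSetting.Model n k))
        (0 : EuclideanSpace ℝ (Fin (n - k)) →L[ℝ] EuclideanSpace ℝ (Fin k)) 0 :=
      (hasFDerivAt_const (0 : EuclideanSpace ℝ (Fin k)) (0 : EuclideanSpace ℝ (Fin (n - k)))).congr_of_eventuallyEq
        (Eventually.of_forall fun y => hKt0 y)
    have heq := hcomp.unique hzero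
    intro y
    have := congrArg (fun φ : EuclideanSpace ℝ (Fin (n - k)) →L[ℝ] EuclideanSpace ℝ (Fin k) => φ y) heq
    simpa using this
  ----------------------------------------------------------------------------------------------
  -- Step 4: `G'` is onto — a right inverse from the right-inverse germ of `K̃` at `y⋆`,
  -- projected to the level along the flow and read in the chart `Φ`
  ----------------------------------------------------------------------------------------------
  obtain ⟨m, hm0, hm⟩ := hKtrank (E pstar) hstar hystarR
  have hθ' := hθ.toPreSlabFlow
  -- the level point of `y⋆` is `ι(Φ⁻¹ z⋆)`
  have hlev0 : Flow.levelProj θ S.g₁ S.c₀ (E pstar) = S.ι (Φ.symm zstar) :=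
    (hθ'.eq_levelProj_of_flowsTo hreg hIcc0 (S.apply_ι _) (Ioo_subset_Icc_self hystarIoo) hflow0).symm
  have hinv0 : (Flow.prodInv θ S.g₁ S.ι S.c₀ (E pstar)).1 = Φ.symm zstar := by
    rw [Flow.prodInv_apply]
    show invFun S.ι (Flow.levelProj θ S.g₁ S.c₀ (E pstar)) = Φ.symm zstar
    rw [hlev0]
    exact leftInverse_invFun S.injective_ι _
  have hmAt : ContMDiffAt 𝓘(ℝ, EuclideanSpace ℝ (Fin k)) (𝓡∂ (n + 1)) ∞ m 0 := hm.self_of_nhds.1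
  have hPinv : ContMDiffAt (𝓡∂ (n + 1)) ((𝓡 n).prod 𝓘(ℝ, ℝ)) ∞ (Flow.prodInv θ S.g₁ S.ι S.c₀) (m 0) := by
    rw [hm0]; exact hθ.contMDiffAt_prodInv hreg S.hι hIcc0 S.range_ι hystarIoo
  have hfstAt : ContMDiffAt 𝓘(ℝ, EuclideanSpace ℝ (Fin k)) (𝓡 n) ∞
      (fun w => (Flow.prodInv θ S.g₁ S.ι S.c₀ (m w)).1) 0 :=
    contMDiffAt_fst.comp 0 (hPinv.comp 0 hmAt)
  have hΦAt : ContMDiffAt (𝓡 n) 𝓘(ℝ, SlideSetting.Model n k) ∞ Φ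
      ((fun w => (Flow.prodInv θ S.g₁ S.ι S.c₀ (m w)).1) 0) := by
    show ContMDiffAt (𝓡 n) 𝓘(ℝ, SlideSetting.Model n k) ∞ Φ (Flow.prodInv θ S.g₁ S.ι S.c₀ (m 0)).1
    rw [hm0, hinv0]
    exact hΦsm.contMDiffAt (Φ.open_source.mem_nhds hqV_src)
  have hmtAt : ContMDiffAt 𝓘(ℝ, EuclideanSpace ℝ (Fin k)) 𝓘(ℝ, SlideSetting.Model n k) ∞
      (fun w => Φ (Flow.prodInv θ S.g₁ S.ι S.c₀ (m w)).1) 0 := hΦAt.comp 0 hfstAt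
  have hmt0 : (fun w => Φ (Flow.prodInv θ S.g₁ S.ι S.c₀ (m w)).1) 0 = zstar := by
    show Φ (Flow.prodInv θ S.g₁ S.ι S.c₀ (m 0)).1 = zstar
    rw [hm0, hinv0]
    exact Φ.right_inv hzstar_tgt
  have hmtd : HasFDerivAt (fun w => Φ (Flow.prodInv θ S.g₁ S.ι S.c₀ (m w)).1)
      (fderiv ℝ (fun w => Φ (Flow.prodInv θ S.g₁ S.ι S.c₀ (m w)).1) 0) 0 :=
    ((contMDiffAt_iff_contDiffAt.1 hmtAt).differentiableAt (by simp)).hasFDerivAt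
  -- `G ∘ m̃ = id` near `0`
  have hGmt : ((fun z : SlideSetting.Model n k => Kt (S.ι (Φ.symm z))) ∘
      fun w => Φ (Flow.prodInv θ S.g₁ S.ι S.c₀ (m w)).1) =ᶠ[𝓝 0] id := by
    -- `g₁ (m w) ∈ (c₀, c₁)` near `0`
    have hmc : ContinuousAt m 0 := hmAt.continuousAt
    have hev1 : ∀ᶠ w in 𝓝 (0 : EuclideanSpace ℝ (Fin k)), S.g₁ (m w) ∈ Ioo S.c₀ S.c₁ := by
      have hc : ContinuousAt (fun w => S.g₁ (m w)) 0 := (S.contMDiff_g₁.continuous.continuousAt).comp hmc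
      refine hc.preimage_mem_nhds (isOpen_Ioo.mem_nhds ?_)
      show S.g₁ (m 0) ∈ Ioo S.c₀ S.c₁
      rw [hm0]; exact hystarIoo
    -- the level point lies in `Φ.source` and in `R` near `0`
    have hev2 : ∀ᶠ w in 𝓝 (0 : EuclideanSpace ℝ (Fin k)), (Flow.prodInv θ S.g₁ S.ι S.c₀ (m w)).1 ∈ Φ.source := by
      refine hfstAt.continuousAt.preimage_mem_nhds (Φ.open_source.mem_nhds ?_)
      show (Flow.prodInv θ S.g₁ S.ι S.c₀ (m 0)).1 ∈ Φ.source
      rw [hm0, hinv0]; exact hqV_src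
    have hev3 : ∀ᶠ w in 𝓝 (0 : EuclideanSpace ℝ (Fin k)), S.ι (Flow.prodInv θ S.g₁ S.ι S.c₀ (m w)).1 ∈ R := by
      have hc : ContinuousAt (fun w => S.ι (Flow.prodInv θ S.g₁ S.ι S.c₀ (m w)).1) 0 :=
        S.continuous_ι.continuousAt.comp hfstAt.continuousAt
      refine hc.preimage_mem_nhds (hRo.mem_nhds ?_)
      show S.ι (Flow.prodInv θ S.g₁ S.ι S.c₀ (m 0)).1 ∈ R
      rw [hm0, hinv0]; exact hy₀R 0
    filter_upwards [hm, hev1, hev2, hev3] with w hw h1 h2 h3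
    obtain ⟨-, hwR, hKw⟩ := hw
    show Kt (S.ι (Φ.symm (Φ (Flow.prodInv θ S.g₁ S.ι S.c₀ (m w)).1))) = w
    rw [Φ.left_inv h2]
    have hιeq : S.ι (Flow.prodInv θ S.g₁ S.ι S.c₀ (m w)).1 = Flow.levelProj θ S.g₁ S.c₀ (m w) := by
      rw [Flow.prodInv_apply]
      exact hθ'.apply_invFun_levelProj hreg hIcc0 S.range_ι (Ioo_subset_Icc_self h1)
    have hfl : FlowsTo (𝓡∂ (n + 1)) (⇑ξ) (S.ι (Flow.prodInv θ S.g₁ S.ι S.c₀ (m w)).1) (m w) := by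
      rw [hιeq]
      exact hθ'.flowsTo_levelProj hreg (Ioo_subset_Icc_self h1) hIcc0 h1.1.le
    rw [hKtinv _ _ h3 hwR hfl, hKw]
  have hGm : G'.comp (fderiv ℝ (fun w => Φ (Flow.prodInv θ S.g₁ S.ι S.c₀ (m w)).1) 0) =
      ContinuousLinearMap.id ℝ (EuclideanSpace ℝ (Fin k)) := by
    have hGd' : HasFDerivAt (fun z : SlideSetting.Model n k => Kt (S.ι (Φ.symm z))) G'
        ((fun w => Φ (Flow.prodInv θ S.g₁ S.ι S.c₀ (m w)).1) 0) := by rw [hmt0]; exact hGd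
    exact (hGd'.comp 0 hmtd).unique ((hasFDerivAt_id (0 : EuclideanSpace ℝ (Fin k))).congr_of_eventuallyEq hGmt)
  have hGmw : ∀ w, G' (fderiv ℝ (fun w => Φ (Flow.prodInv θ S.g₁ S.ι S.c₀ (m w)).1) 0 w) = w := fun w => by
    have := congrArg (fun φ : EuclideanSpace ℝ (Fin k) →L[ℝ] EuclideanSpace ℝ (Fin k) => φ w) hGm
    simpa using this
  ----------------------------------------------------------------------------------------------
  -- Step 5: `K̃ ∘ E = G ∘ Ψ` near `p⋆`, with `Ψ(L_k(a, x)) = (1 + (3/2) λ(2ν(a) - 1), X(x), 0)`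
  ----------------------------------------------------------------------------------------------
  -- the sheet coordinate and the sweep profile
  obtain ⟨d, hd, hσd⟩ := hasDerivAt_sweepProfile (astar := astar) h12 (by rw [← hνt]; exact hlam)
  -- the linear coordinates `a`, `x` of `p = L_k(a, x)`
  set φ₁ : EuclideanSpace ℝ (Fin k) →L[ℝ] ℝ :=
    (ContinuousLinearMap.fst ℝ ℝ (EuclideanSpace ℝ (Fin (k - 1)))).comp
      (S.Lk.symm : EuclideanSpace ℝ (Fin k) →L[ℝ] ℝ × EuclideanSpace ℝ (Fin (k - 1))) with hφ₁
  set φ₂ : EuclideanSpace ℝ (Fin k) →L[ℝ] EuclideanSpace ℝ (Fin (k - 1)) :=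
    (ContinuousLinearMap.snd ℝ ℝ (EuclideanSpace ℝ (Fin (k - 1)))).comp
      (S.Lk.symm : EuclideanSpace ℝ (Fin k) →L[ℝ] ℝ × EuclideanSpace ℝ (Fin (k - 1))) with hφ₂
  have hφ₁d : HasFDerivAt (fun p : EuclideanSpace ℝ (Fin k) => (S.Lk.symm p).1) φ₁ pstar := φ₁.hasFDerivAt
  have hφ₂d : HasFDerivAt (fun p : EuclideanSpace ℝ (Fin k) => (S.Lk.symm p).2) φ₂ pstar := φ₂.hasFDerivAt
  -- the map `Ψ` and its derivative at `p⋆`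
  set Ψ : EuclideanSpace ℝ (Fin k) → SlideSetting.Model n k := fun p =>
    ((1 + Real.smoothTransition (2 * Real.smoothTransition ((t₂' - (S.Lk.symm p).1) / (t₂' - t₁')) - 1) *
        (5 / 2 - 1),
      (S.preB ((univBall (0 : EuclideanSpace ℝ (Fin n)) S.rA).symm
        (S.L₃.symm (((0 : ℝ), (S.Lk.symm p).2, (0 : EuclideanSpace ℝ (Fin (n - k)))) : SlideSetting.Model n k)))).2.1,
      (0 : EuclideanSpace ℝ (Fin (n - k)))) : SlideSetting.Model n k) with hΨ
  have hXd' : HasFDerivAt (fun x : EuclideanSpace ℝ (Fin (k - 1)) =>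
      (S.preB ((univBall (0 : EuclideanSpace ℝ (Fin n)) S.rA).symm
        (S.L₃.symm (((0 : ℝ), x, (0 : EuclideanSpace ℝ (Fin (n - k)))) : SlideSetting.Model n k)))).2.1) X'
      ((fun p : EuclideanSpace ℝ (Fin k) => (S.Lk.symm p).2) pstar) := by
    show HasFDerivAt _ X' (S.Lk.symm pstar).2
    rw [hx0]; exact hXd
  have hσd' : HasDerivAt (fun a' : ℝ => 1 + Real.smoothTransition
      (2 * Real.smoothTransition ((t₂' - a') / (t₂' - t₁')) - 1) * (5 / 2 - 1)) d
      ((fun p : EuclideanSpace ℝ (Fin k) => (S.Lk.symm p).1) pstar) := hσd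
  have hΨd : HasFDerivAt Ψ ((d • φ₁).prod ((X'.comp φ₂).prod (0 : EuclideanSpace ℝ (Fin k) →L[ℝ] EuclideanSpace ℝ (Fin (n - k))))) pstar := by
    show HasFDerivAt (fun p : EuclideanSpace ℝ (Fin k) =>
      ((1 + Real.smoothTransition (2 * Real.smoothTransition ((t₂' - (S.Lk.symm p).1) / (t₂' - t₁')) - 1) *
          (5 / 2 - 1),
        (S.preB ((univBall (0 : EuclideanSpace ℝ (Fin n)) S.rA).symm
          (S.L₃.symm (((0 : ℝ), (S.Lk.symm p).2, (0 : EuclideanSpace ℝ (Fin (n - k)))) : SlideSetting.Model n k)))).2.1,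
        (0 : EuclideanSpace ℝ (Fin (n - k)))) : SlideSetting.Model n k)) _ pstar
    exact (hσd'.comp_hasFDerivAt pstar hφ₁d).prodMk ((hXd'.comp pstar hφ₂d).prodMk
      (hasFDerivAt_const (0 : EuclideanSpace ℝ (Fin (n - k))) pstar))
  have hΨstar : Ψ pstar = zstar := by
    have hA0 : (univBall (0 : EuclideanSpace ℝ (Fin n)) S.rA).symm 0 = 0 := by
      have h := (univBall (0 : EuclideanSpace ℝ (Fin n)) S.rA).left_inv (x := 0) (by rw [univBall_source]; trivial)
      rwa [univBall_apply_zero] at h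
    show ((1 + Real.smoothTransition (2 * Real.smoothTransition ((t₂' - (S.Lk.symm pstar).1) / (t₂' - t₁')) - 1) *
        (5 / 2 - 1),
      (S.preB ((univBall (0 : EuclideanSpace ℝ (Fin n)) S.rA).symm
        (S.L₃.symm (((0 : ℝ), (S.Lk.symm pstar).2, (0 : EuclideanSpace ℝ (Fin (n - k)))) : SlideSetting.Model n k)))).2.1,
      (0 : EuclideanSpace ℝ (Fin (n - k)))) : SlideSetting.Model n k) = zstar
    rw [hx0, ← hνt, hlam]
    rw [show S.L₃.symm (((0 : ℝ), (0 : EuclideanSpace ℝ (Fin (k - 1))), (0 : EuclideanSpace ℝ (Fin (n - k)))) :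
      SlideSetting.Model n k) = 0 from map_zero _, hA0, S.preB_zero]
    refine Prod.ext ?_ (Prod.ext rfl rfl)
    show (1 : ℝ) + 2 / 3 * (5 / 2 - 1) = 2
    norm_num
  have hGdΨ : HasFDerivAt (fun z : SlideSetting.Model n k => Kt (S.ι (Φ.symm z))) G' (Ψ pstar) := by
    rw [hΨstar]; exact hGd
  have hL : HasFDerivAt ((fun z : SlideSetting.Model n k => Kt (S.ι (Φ.symm z))) ∘ Ψ)
      (G'.comp ((d • φ₁).prod ((X'.comp φ₂).prod (0 : EuclideanSpace ℝ (Fin k) →L[ℝ] EuclideanSpace ℝ (Fin (n - k)))))) pstar :=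
    hGdΨ.comp pstar hΨd
  -- `K̃ ∘ E = G ∘ Ψ` near `p⋆`
  have hEc : ContinuousAt E pstar := (hEs.continuousOn.continuousWithinAt hpstar).continuousAt (hVko.mem_nhds hpstar)
  have hfeq : (fun p => Kt (E p)) =ᶠ[𝓝 pstar] ((fun z : SlideSetting.Model n k => Kt (S.ι (Φ.symm z))) ∘ Ψ) := by
    -- (E1) `p ∈ Vk`
    have hE1 : ∀ᶠ p in 𝓝 pstar, p ∈ Vk := hVko.mem_nhds hpstar
    -- (E2) `E p ∈ R`
    have hE2 : ∀ᶠ p in 𝓝 pstar, E p ∈ R := hEc.preimage_mem_nhds (hRo.mem_nhds hystarR)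
    -- (E3) the sheet point lies in the ball of the squeeze
    have hshc : Continuous fun p : EuclideanSpace ℝ (Fin k) =>
        S.L₃.symm (((0 : ℝ), (S.Lk.symm p).2, (0 : EuclideanSpace ℝ (Fin (n - k)))) : SlideSetting.Model n k) :=
      S.L₃.symm.continuous.comp (continuous_const.prodMk ((continuous_snd.comp S.Lk.symm.continuous).prodMk continuous_const))
    have hsh0 : S.L₃.symm (((0 : ℝ), (S.Lk.symm pstar).2, (0 : EuclideanSpace ℝ (Fin (n - k)))) : SlideSetting.Model n k) = 0 := by
      rw [hx0]; exact map_zero _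
    have hE3 : ∀ᶠ p in 𝓝 pstar,
        S.L₃.symm (((0 : ℝ), (S.Lk.symm p).2, (0 : EuclideanSpace ℝ (Fin (n - k)))) : SlideSetting.Model n k) ∈
          ball (0 : EuclideanSpace ℝ (Fin n)) S.rA := by
      refine hshc.continuousAt.preimage_mem_nhds (isOpen_ball.mem_nhds ?_)
      rw [hsh0]; exact mem_ball_self S.rA_pos
    -- (E4) the docked flat vector has norm `≤ 1/8`
    have hvc : ContinuousAt (fun p : EuclideanSpace ℝ (Fin k) => (univBall (0 : EuclideanSpace ℝ (Fin n)) S.rA).symm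
        (S.L₃.symm (((0 : ℝ), (S.Lk.symm p).2, (0 : EuclideanSpace ℝ (Fin (n - k)))) : SlideSetting.Model n k))) pstar := by
      refine ContinuousAt.comp ?_ hshc.continuousAt
      rw [hsh0]
      exact (univBall (0 : EuclideanSpace ℝ (Fin n)) S.rA).continuousAt_symm
        (by rw [univBall_target _ S.rA_pos]; exact mem_ball_self S.rA_pos)
    have hv0 : (univBall (0 : EuclideanSpace ℝ (Fin n)) S.rA).symm
        (S.L₃.symm (((0 : ℝ), (S.Lk.symm pstar).2, (0 : EuclideanSpace ℝ (Fin (n - k)))) : SlideSetting.Model n k)) = 0 := by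
      rw [hsh0]
      have h := (univBall (0 : EuclideanSpace ℝ (Fin n)) S.rA).left_inv (x := 0) (by rw [univBall_source]; trivial)
      rwa [univBall_apply_zero] at h
    have hE4 : ∀ᶠ p in 𝓝 pstar, ‖(univBall (0 : EuclideanSpace ℝ (Fin n)) S.rA).symm
        (S.L₃.symm (((0 : ℝ), (S.Lk.symm p).2, (0 : EuclideanSpace ℝ (Fin (n - k)))) : SlideSetting.Model n k))‖ < 1 / 8 := by
      refine hvc.norm.eventually_lt continuousAt_const ?_
      show ‖(univBall (0 : EuclideanSpace ℝ (Fin n)) S.rA).symm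
        (S.L₃.symm (((0 : ℝ), (S.Lk.symm pstar).2, (0 : EuclideanSpace ℝ (Fin (n - k)))) : SlideSetting.Model n k))‖ < 1 / 8
      rw [hv0, norm_zero]; norm_num
    -- (E5) the sweep time is `≥ 1/2`
    have hνstar : 1 / 2 < ν astar := by
      have hI := SlideSetting.mem_Ioo_of_smoothTransition_mem_Ioo (x := 2 * ν astar - 1)
        (by rw [hlam]; norm_num) (by rw [hlam]; norm_num)
      linarith [hI.1]
    have hE5 : ∀ᶠ p in 𝓝 pstar, 1 / 2 < ν (S.Lk.symm p).1 := by
      have hc : ContinuousAt (fun p : EuclideanSpace ℝ (Fin k) => ν (S.Lk.symm p).1) pstar :=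
        (hνc.comp (continuous_fst.comp S.Lk.symm.continuous)).continuousAt
      exact continuousAt_const.eventually_lt hc hνstar
    -- (E6) the isotoped sheet point, on the level, lies in `R`
    have hqc : ContinuousAt (fun p : EuclideanSpace ℝ (Fin k) =>
        S.ι (F.toFun (ν (S.Lk.symm p).1) (S.psiL ρ (((0 : ℝ), (S.Lk.symm p).2,
          (0 : EuclideanSpace ℝ (Fin (n - k)))) : SlideSetting.Model n k)))) pstar := by
      have hF : Continuous (uncurry F.toFun) := F.contMDiff.continuous
      have hνp : Continuous fun p : EuclideanSpace ℝ (Fin k) => ν (S.Lk.symm p).1 :=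
        hνc.comp (continuous_fst.comp S.Lk.symm.continuous)
      have hsrc : (((0 : ℝ), (S.Lk.symm pstar).2, (0 : EuclideanSpace ℝ (Fin (n - k)))) : SlideSetting.Model n k) ∈
          (S.psiL ρ).source := by
        rw [S.mem_psiL_source_iff, hx0]
        simpa using S.xL_mem_target
      have hA : ContinuousAt (fun p : EuclideanSpace ℝ (Fin k) => S.psiL ρ (((0 : ℝ), (S.Lk.symm p).2,
          (0 : EuclideanSpace ℝ (Fin (n - k)))) : SlideSetting.Model n k)) pstar := by
        refine ContinuousAt.comp ((S.psiL ρ).continuousAt hsrc) ?_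
        exact (continuous_const.prodMk ((continuous_snd.comp S.Lk.symm.continuous).prodMk continuous_const)).continuousAt
      exact S.continuous_ι.continuousAt.comp (hF.continuousAt.comp (hνp.continuousAt.prodMk hA))
    have hq0 : S.ι (F.toFun (ν (S.Lk.symm pstar).1) (S.psiL ρ (((0 : ℝ), (S.Lk.symm pstar).2,
        (0 : EuclideanSpace ℝ (Fin (n - k)))) : SlideSetting.Model n k))) = S.ι (Φ.symm zstar) := by
      rw [hx0, S.psiL_sheet_zero ρ]
      show S.ι (F.toFun (ν astar) (S.discA ρ 0)) = _
      rw [hFstar]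
    have hE6 : ∀ᶠ p in 𝓝 pstar, S.ι (F.toFun (ν (S.Lk.symm p).1) (S.psiL ρ (((0 : ℝ), (S.Lk.symm p).2,
        (0 : EuclideanSpace ℝ (Fin (n - k)))) : SlideSetting.Model n k))) ∈ R := by
      refine hqc.preimage_mem_nhds (hRo.mem_nhds ?_)
      rw [hq0]; exact hy₀R 0
    -- (E7) the sheet coordinate is small: `α = 5/2` there
    have hE7 : ∀ᶠ p in 𝓝 pstar, ‖(S.preB ((univBall (0 : EuclideanSpace ℝ (Fin n)) S.rA).symm
        (S.L₃.symm (((0 : ℝ), (S.Lk.symm p).2, (0 : EuclideanSpace ℝ (Fin (n - k)))) : SlideSetting.Model n k)))).2.1‖ ^ 2 < δ := by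
      have hc : ContinuousAt (fun p : EuclideanSpace ℝ (Fin k) => ‖(S.preB ((univBall (0 : EuclideanSpace ℝ (Fin n)) S.rA).symm
          (S.L₃.symm (((0 : ℝ), (S.Lk.symm p).2, (0 : EuclideanSpace ℝ (Fin (n - k)))) : SlideSetting.Model n k)))).2.1‖ ^ 2) pstar :=
        ((continuous_fst.comp continuous_snd).continuousAt.comp (S.continuous_preB.continuousAt.comp hvc)).norm.pow 2
      have h0 : ‖(S.preB ((univBall (0 : EuclideanSpace ℝ (Fin n)) S.rA).symm
          (S.L₃.symm (((0 : ℝ), (S.Lk.symm pstar).2, (0 : EuclideanSpace ℝ (Fin (n - k)))) : SlideSetting.Model n k)))).2.1‖ ^ 2 = 0 := by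
        rw [hv0, S.preB_zero]
        simp
      refine hc.eventually_lt continuousAt_const ?_
      show ‖(S.preB ((univBall (0 : EuclideanSpace ℝ (Fin n)) S.rA).symm
          (S.L₃.symm (((0 : ℝ), (S.Lk.symm pstar).2, (0 : EuclideanSpace ℝ (Fin (n - k)))) : SlideSetting.Model n k)))).2.1‖ ^ 2 < δ
      rw [h0]; exact hδ
    filter_upwards [hE1, hE2, hE3, hE4, hE5, hE6, hE7] with p h1 h2 h3 h4 h5 h6 h7
    -- abbreviations
    obtain ⟨hgp, hpI, hflowp⟩ := hEp p h1
    set x : EuclideanSpace ℝ (Fin (k - 1)) := (S.Lk.symm p).2 with hxdef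
    set v : EuclideanSpace ℝ (Fin n) := (univBall (0 : EuclideanSpace ℝ (Fin n)) S.rA).symm
      (S.L₃.symm (((0 : ℝ), x, (0 : EuclideanSpace ℝ (Fin (n - k)))) : SlideSetting.Model n k)) with hvdef
    obtain ⟨hAx, hvF⟩ := S.discA_symm_sheet ρ h3
    -- flow invariance of `K̃`
    have hK1 : Kt (E p) = Kt (S.ι (F.toFun (ν (S.Lk.symm p).1) (S.psiL ρ (((0 : ℝ), x,
        (0 : EuclideanSpace ℝ (Fin (n - k)))) : SlideSetting.Model n k)))) :=
      (hKtinv _ _ h6 h2 hflowp).symm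
    -- the formula of the isotopy at the docked flat vector
    have hΨp : Ψ p = ((1 + Real.smoothTransition (2 * ν (S.Lk.symm p).1 - 1) * (5 / 2 - 1),
        (S.preB v).2.1, (0 : EuclideanSpace ℝ (Fin (n - k)))) : SlideSetting.Model n k) := by
      simp only [hΨ, hνt, hvdef, hxdef]
    show Kt (E p) = Kt (S.ι (Φ.symm (Ψ p)))
    rw [hK1, hΨp, ← hAx, hformula _ h5.le v hvF h4.le, hαδ _ h7.le]
  have hfd : HasFDerivAt (fun p => Kt (E p))
      (G'.comp ((d • φ₁).prod ((X'.comp φ₂).prod (0 : EuclideanSpace ℝ (Fin k) →L[ℝ] EuclideanSpace ℝ (Fin (n - k)))))) pstar :=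
    hL.congr_of_eventuallyEq hfeq
  ----------------------------------------------------------------------------------------------
  -- Step 6: the derivative is invertible; conclude by the crossing formula
  ----------------------------------------------------------------------------------------------
  have hLdet : LinearMap.det ((G'.comp ((d • φ₁).prod ((X'.comp φ₂).prod
      (0 : EuclideanSpace ℝ (Fin k) →L[ℝ] EuclideanSpace ℝ (Fin (n - k)))))) :
        EuclideanSpace ℝ (Fin k) →ₗ[ℝ] EuclideanSpace ℝ (Fin k)) ≠ 0 :=
    crossing_det_ne_zero S.hk1 G' _ hGmw hY hd.ne X' hX'inj S.Lk.symm
  -- the datum's `K` agrees with `K̃ ∘ E` near `p⋆`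
  have hf : ∀ᶠ w in 𝓝 pstar, ∀ (hw : w ∈ Vk) (hN : (⟨E w, h₁' (hE w hw)⟩ : ↥X) ∈ Tj.N),
      (fun p => Kt (E p)) w = Tj.K ⟨⟨E w, h₁' (hE w hw)⟩, hN⟩ := by
    filter_upwards [hEc.preimage_mem_nhds (hRo.mem_nhds hystarR)] with w hw hwV hN
    obtain ⟨hN', hK⟩ := hKtK ⟨E w, h₁' (hE w hwV)⟩ hw
    exact hK.symm
  -- the hypotheses on the new pair at `σ i`
  have hpk : σ i ∈ criticalSetOfIndex (𝓡∂ (n + 1)) g' k := by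
    refine ⟨?_, ?_⟩
    · have : σ i ∈ criticalSet (𝓡∂ (n + 1)) g' := by rw [hcrit']; exact S.σ_mem_criticalSet i
      exact this
    · rw [hind _ (S.σ_mem_criticalSet i), S.morseIndex_σ i]
  have htp : t₀ < g' (σ i) := by rw [hval i]; exact S.ht₀b
  have hnoval : ∀ z ∈ criticalSet (𝓡∂ (n + 1)) g', g' z ∉ Ico t₀ (g' (σ i)) := fun z hz => by
    rw [hval i]; exact S.apply_notMem_Ico_of_mem_criticalSet hcrit' hval halt hz
  have hlev : g' (E pstar) ≠ t₀ := by
    have h1 : g' (E pstar) ∈ Ioo S.u S.v := hIoo _ (hband_uv _ hystarIoo.1.le hystarIoo.2)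
    exact (S.ht₀u.trans h1.1).ne'
  ----------------------------------------------------------------------------------------------
  -- Step 7: the derivative at the crossing is `L₀` precomposed with the scaling `a ↦ d a`
  ----------------------------------------------------------------------------------------------
  have hGG₀ : G' = fderiv ℝ (fun z : SlideSetting.Model n k => Kt (S.ι (S.psiR z))) zstar := by
    apply Filter.EventuallyEq.fderiv_eq
    filter_upwards [hOo.mem_nhds (hOsub (show zstar.1 = 2 ∧ zstar.2.1 = 0 from ⟨rfl, rfl⟩))] with z hz
    show Kt (S.ι (Φ.symm z)) = Kt (S.ι (S.psiR z))
    rw [hO z hz]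
  set Sd : EuclideanSpace ℝ (Fin k) →L[ℝ] EuclideanSpace ℝ (Fin k) :=
    (S.Lk : (ℝ × EuclideanSpace ℝ (Fin (k - 1))) →L[ℝ] EuclideanSpace ℝ (Fin k)).comp
      (((d • ContinuousLinearMap.fst ℝ ℝ (EuclideanSpace ℝ (Fin (k - 1)))).prod
        (ContinuousLinearMap.snd ℝ ℝ (EuclideanSpace ℝ (Fin (k - 1))))).comp
        (S.Lk.symm : EuclideanSpace ℝ (Fin k) →L[ℝ] ℝ × EuclideanSpace ℝ (Fin (k - 1)))) with hSd
  have hSapply : ∀ p, S.Lk.symm (Sd p) = (d * (S.Lk.symm p).1, (S.Lk.symm p).2) := fun p => by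
    simp only [hSd, ContinuousLinearMap.comp_apply, ContinuousLinearEquiv.coe_coe,
      ContinuousLinearEquiv.symm_apply_apply, ContinuousLinearMap.prod_apply,
      FunLike.coe_smul, Pi.smul_apply, ContinuousLinearMap.coe_fst', ContinuousLinearMap.coe_snd',
      smul_eq_mul]
  have hLω : G'.comp ((d • φ₁).prod ((X'.comp φ₂).prod
      (0 : EuclideanSpace ℝ (Fin k) →L[ℝ] EuclideanSpace ℝ (Fin (n - k))))) = L₀.comp Sd := by
    refine ContinuousLinearMap.ext fun p => ?_
    rw [hL₀, ← hGG₀]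
    show G' ((d • φ₁) p, X' (φ₂ p), (0 : EuclideanSpace ℝ (Fin (n - k)))) =
      G' ((S.Lk.symm (Sd p)).1, X' (S.Lk.symm (Sd p)).2, (0 : EuclideanSpace ℝ (Fin (n - k))))
    rw [hSapply]
    rfl
  have hdetSd : LinearMap.det (Sd : EuclideanSpace ℝ (Fin k) →ₗ[ℝ] EuclideanSpace ℝ (Fin k)) = d := by
    have h1 : (Sd : EuclideanSpace ℝ (Fin k) →ₗ[ℝ] EuclideanSpace ℝ (Fin k)) =
        (S.Lk.toLinearEquiv : (ℝ × EuclideanSpace ℝ (Fin (k - 1))) →ₗ[ℝ] EuclideanSpace ℝ (Fin k)) ∘ₗ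
          (LinearMap.prodMap (d • LinearMap.id) LinearMap.id :
            (ℝ × EuclideanSpace ℝ (Fin (k - 1))) →ₗ[ℝ] ℝ × EuclideanSpace ℝ (Fin (k - 1))) ∘ₗ
          (S.Lk.toLinearEquiv.symm : EuclideanSpace ℝ (Fin k) →ₗ[ℝ] ℝ × EuclideanSpace ℝ (Fin (k - 1))) := by
      apply LinearMap.ext
      intro p
      rfl
    rw [h1, LinearMap.det_conj, LinearMap.det_prodMap, LinearMap.det_smul, LinearMap.det_id,
      LinearMap.det_id, Module.finrank_self, pow_one, mul_one, mul_one]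
  have hdetω : LinearMap.det ((G'.comp ((d • φ₁).prod ((X'.comp φ₂).prod
      (0 : EuclideanSpace ℝ (Fin k) →L[ℝ] EuclideanSpace ℝ (Fin (n - k))))) :
        EuclideanSpace ℝ (Fin k) →ₗ[ℝ] EuclideanSpace ℝ (Fin k))) =
      LinearMap.det (L₀ : EuclideanSpace ℝ (Fin k) →ₗ[ℝ] EuclideanSpace ℝ (Fin k)) * d := by
    rw [hLω]
    show LinearMap.det ((L₀ : EuclideanSpace ℝ (Fin k) →ₗ[ℝ] EuclideanSpace ℝ (Fin k)).comp
      (Sd : EuclideanSpace ℝ (Fin k) →ₗ[ℝ] EuclideanSpace ℝ (Fin k))) = _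
    rw [LinearMap.det_comp, hdetSd]
  have hL₀det : LinearMap.det (L₀ : EuclideanSpace ℝ (Fin k) →ₗ[ℝ] EuclideanSpace ℝ (Fin k)) ≠ 0 :=
    fun h => hLdet (by rw [hdetω, h, zero_mul])
  have hsgn : ((SignType.sign (LinearMap.det ((G'.comp ((d • φ₁).prod ((X'.comp φ₂).prod
      (0 : EuclideanSpace ℝ (Fin k) →L[ℝ] EuclideanSpace ℝ (Fin (n - k))))) :
        EuclideanSpace ℝ (Fin k) →ₗ[ℝ] EuclideanSpace ℝ (Fin k)))) : ℤ)) =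
      -((SignType.sign (LinearMap.det (L₀ : EuclideanSpace ℝ (Fin k) →ₗ[ℝ] EuclideanSpace ℝ (Fin k)))) : ℤ) := by
    rw [hdetω, sign_mul, sign_neg hd, mul_neg_one, SignType.coe_neg]
  ----------------------------------------------------------------------------------------------
  -- Step 8: the chart as a Euclidean model of an open piece `U` of the new disc; incidence `η`
  ----------------------------------------------------------------------------------------------
  set φ : C(↥(leftHandDisc (𝓡∂ (n + 1)) g' ξ₃ (σ i) t₀), ↥X) :=
    ⟨Set.inclusion h₁', continuous_inclusion h₁'⟩ with hφ
  set ch : ↥Vk → ↥(leftHandDisc (𝓡∂ (n + 1)) g' ξ₃ (σ i) t₀) := fun w => ⟨E w, hE w w.2⟩ with hch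
  have hchO : Topology.IsOpenEmbedding ch := ⟨hemb, hopen⟩
  set U : Set ↥(leftHandDisc (𝓡∂ (n + 1)) g' ξ₃ (σ i) t₀) := range ch with hU
  set e : ↥Vk ≃ₜ ↥U := hemb.toHomeomorph with he
  have hEband : ∀ w ∈ Vk, S.g₁ (E w) ∈ Ioo S.c₀ S.c₁ := fun w hw => by
    obtain ⟨h1, h2, -⟩ := hEp w hw
    rw [h1]; exact h2
  have hEt₀ : ∀ w ∈ Vk, g' (E w) ≠ t₀ := fun w hw =>
    (S.lt_newFunction_of_c₀_lt hIoo halt (hEband w hw).1).ne'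
  have hUB : U ⊆ (Subtype.val ⁻¹' leftHandSphere (𝓡∂ (n + 1)) g' ξ₃ (σ i) t₀)ᶜ := by
    rintro _ ⟨w, rfl⟩ h
    exact hEt₀ w w.2 h.2
  have hVkc : IsPreconnected Vk := S.isPreconnected_of_iff_chartDomain ρ hVk
  have hgenU : ∀ u : ↥U, ∃ f : localHomology ℤ ℤ _ (u : ↥(leftHandDisc (𝓡∂ (n + 1)) g' ξ₃ (σ i) t₀)) k ≃ₗ[ℤ] ℤ,
      f (relLocalFamily γ₀ (u : ↥(leftHandDisc (𝓡∂ (n + 1)) g' ξ₃ (σ i) t₀))) = 1 := by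
    intro u
    obtain ⟨w, hw⟩ := u.2
    have hlev' : g' (u : ↥(leftHandDisc (𝓡∂ (n + 1)) g' ξ₃ (σ i) t₀)).1 ≠ t₀ := by
      rw [← hw]; exact hEt₀ w w.2
    obtain ⟨f₀, hf₀⟩ := Cobordism.isGenerator_localisation_leftHandDisc hg' ξ₃ hξg' S.ht₀ hpk htp hnoval γ₀ hγ₀
      _ hlev'
    refine ⟨f₀, ?_⟩
    rw [relLocalFamily_apply _ (hUB u.2)]
    exact hf₀
  obtain ⟨η, hη⟩ := exists_units_forall_toLocal_eq_incidence g𝔼 hopen hUB hVko hVkc e γ₀ hgenU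
  ----------------------------------------------------------------------------------------------
  -- Step 9: the crossing formula with incidence `η` on a small chart about `p⋆`
  ----------------------------------------------------------------------------------------------
  obtain ⟨Of, hOf, hOfo, hpOf⟩ := _root_.eventually_nhds_iff.1 hf
  have hWk : IsOpen (ch ⁻¹' ((φ : ↥(leftHandDisc (𝓡∂ (n + 1)) g' ξ₃ (σ i) t₀) → ↥X) ⁻¹' Tj.N)) :=
    (Tj.isOpen_N.preimage φ.continuous).preimage hemb.continuous
  obtain ⟨ON, hONo, hONeq⟩ := isOpen_induced_iff.1 hWk
  let V' : Set (EuclideanSpace ℝ (Fin k)) := Vk ∩ ON ∩ Of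
  have hV'o : IsOpen V' := (hVko.inter hONo).inter hOfo
  have hV'V : V' ⊆ Vk := fun w hw => hw.1.1
  have hN' : ∀ w (hw : w ∈ V'), φ (ch ⟨w, hw.1.1⟩) ∈ Tj.N := by
    intro w hw
    have : (⟨w, hw.1.1⟩ : ↥Vk) ∈ ch ⁻¹' ((φ : ↥(leftHandDisc (𝓡∂ (n + 1)) g' ξ₃ (σ i) t₀) → ↥X) ⁻¹' Tj.N) := by
      rw [← hONeq]; exact hw.1.2
    exact this
  have hpstarN : φ (ch ⟨pstar, hpstar⟩) ∈ Tj.N := Tj.subset ((hPj _).2 hstar)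
  have hpstar' : pstar ∈ V' := by
    refine ⟨⟨hpstar, ?_⟩, hpOf⟩
    have : (⟨pstar, hpstar⟩ : ↥Vk) ∈ ch ⁻¹' ((φ : ↥(leftHandDisc (𝓡∂ (n + 1)) g' ξ₃ (σ i) t₀) → ↥X) ⁻¹' Tj.N) :=
      hpstarN
    rw [← hONeq] at this
    exact this
  let ch' : ↥V' → ↥(leftHandDisc (𝓡∂ (n + 1)) g' ξ₃ (σ i) t₀) := fun w => ch (Set.inclusion hV'V w)
  have hemb' : Topology.IsEmbedding ch' := hemb.comp (Topology.IsEmbedding.inclusion hV'V)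
  let U' : Set ↥(leftHandDisc (𝓡∂ (n + 1)) g' ξ₃ (σ i) t₀) := range ch'
  let e' : ↥V' ≃ₜ ↥U' := hemb'.toHomeomorph
  have hU'U : U' ⊆ U := by
    rintro _ ⟨w, rfl⟩
    exact ⟨Set.inclusion hV'V w, rfl⟩
  have hUN' : ∀ t ∈ U', φ t ∈ Tj.N := by
    rintro _ ⟨w, rfl⟩
    exact hN' w.1 w.2
  have hv₀ : (((e' ⟨pstar, hpstar'⟩ : ↥U') : ↥(leftHandDisc (𝓡∂ (n + 1)) g' ξ₃ (σ i) t₀)) : c.W) = E pstar := rfl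
  have hF : {t : ↥(leftHandDisc (𝓡∂ (n + 1)) g' ξ₃ (σ i) t₀) | φ t ∈ Tj.P} =
      {((e' ⟨pstar, hpstar'⟩ : ↥U') : ↥(leftHandDisc (𝓡∂ (n + 1)) g' ξ₃ (σ i) t₀))} := by
    ext t
    rw [mem_setOf_eq, mem_singleton_iff, hPj]
    constructor
    · intro ht
      exact Subtype.ext ((huniq t.1 t.2 ht).trans hv₀.symm)
    · intro ht
      rw [ht]
      show (((e' ⟨pstar, hpstar'⟩ : ↥U') : ↥(leftHandDisc (𝓡∂ (n + 1)) g' ξ₃ (σ i) t₀)) : c.W) ∈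
        unstableSet (𝓡∂ (n + 1)) ξ (σ j)
      rw [hv₀]; exact hstar
  have hf' : ∀ w : ↥V', (fun p => Kt (E p)) w = Tj.K ⟨φ (e' w), hUN' _ (e' w).2⟩ := fun w =>
    hOf w.1 w.2.2 w.2.1.1 _
  -- the model class at `p⋆`, read in the small chart, is the one read in the big chart
  have hE1 : relativeSingularHomology.map ℤ ℤ (subsetIncl U')
      (localHomology.mapsTo_subsetIncl_compl (e' ⟨pstar, hpstar'⟩).2) k
      (localHomology.xEquiv ℤ ℤ e' ⟨pstar, hpstar'⟩ k
        ((localHomology.openSubsetIso ℤ ℤ hV'o hpstar' k).inv (g𝔼.localClass pstar))) =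
      relativeSingularHomology.map ℤ ℤ (subsetIncl U)
        (localHomology.mapsTo_subsetIncl_compl (e ⟨pstar, hpstar⟩).2) k
        (localHomology.xEquiv ℤ ℤ e ⟨pstar, hpstar⟩ k
          ((localHomology.openSubsetIso ℤ ℤ hVko hpstar k).inv (g𝔼.localClass pstar))) := by
    have hsq : ∀ v : ↥V', subsetInclusion hU'U (e' v) = e (Set.inclusion hV'V v) := fun v => rfl
    have hf₁ : MapsTo (subsetInclusion hV'V) ({(⟨pstar, hpstar'⟩ : ↥V')}ᶜ : Set ↥V')
        ({(⟨pstar, hpstar⟩ : ↥Vk)}ᶜ : Set ↥Vk) :=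
      mapsTo_compl_singleton_of_injective (inclusion_injective hV'V) rfl
    have hg₁ : MapsTo (subsetInclusion hU'U) ({e' ⟨pstar, hpstar'⟩}ᶜ : Set ↥U')
        ({e ⟨pstar, hpstar⟩}ᶜ : Set ↥U) :=
      mapsTo_compl_singleton_of_injective (inclusion_injective hU'U) (hsq _)
    have hnat := relativeSingularHomology.xEquiv_map ℤ ℤ e' e (subsetInclusion hV'V) (subsetInclusion hU'U) hsq
      (mapsTo_compl_singleton e'.toEquiv ⟨pstar, hpstar'⟩)
      (mapsTo_symm_compl_singleton e'.toEquiv ⟨pstar, hpstar'⟩)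
      (mapsTo_compl_singleton e.toEquiv ⟨pstar, hpstar⟩) (mapsTo_symm_compl_singleton e.toEquiv ⟨pstar, hpstar⟩)
      hf₁ hg₁ k ((localHomology.openSubsetIso ℤ ℤ hV'o hpstar' k).inv (g𝔼.localClass pstar))
    rw [← map_subsetInclusion_openSubsetIso_inv hV'o hVko hV'V ⟨pstar, hpstar'⟩ (g𝔼.localClass pstar)]
    change _ = relativeSingularHomology.map ℤ ℤ (subsetIncl U) _ k
      (relativeSingularHomology.xEquiv ℤ ℤ e _ _ k (relativeSingularHomology.map ℤ ℤ (subsetInclusion hV'V) hf₁ k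
        ((localHomology.openSubsetIso ℤ ℤ hV'o hpstar' k).inv (g𝔼.localClass pstar))))
    rw [hnat]
    have hcomp : (subsetIncl U).comp (subsetInclusion hU'U) = subsetIncl U' := by ext w; rfl
    have hmaps_eq : relativeSingularHomology.map ℤ ℤ (subsetIncl U')
        (localHomology.mapsTo_subsetIncl_compl (e' ⟨pstar, hpstar'⟩).2) k =
        relativeSingularHomology.map ℤ ℤ (subsetInclusion hU'U) hg₁ k ≫
          relativeSingularHomology.map ℤ ℤ (subsetIncl U)
            (localHomology.mapsTo_subsetIncl_compl (e ⟨pstar, hpstar⟩).2) k := by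
      rw [← relativeSingularHomology.map_comp]
      exact relativeSingularHomology.map_congr ℤ ℤ hcomp.symm _ _ k
    rw [hmaps_eq]
    rfl
  have hBstar : MapsTo (ContinuousMap.id ↥(leftHandDisc (𝓡∂ (n + 1)) g' ξ₃ (σ i) t₀))
      (Subtype.val ⁻¹' leftHandSphere (𝓡∂ (n + 1)) g' ξ₃ (σ i) t₀)
      ({((e ⟨pstar, hpstar⟩ : ↥U) : ↥(leftHandDisc (𝓡∂ (n + 1)) g' ξ₃ (σ i) t₀))}ᶜ : Set _) := by
    intro z hz h
    rw [ContinuousMap.id_apply, mem_singleton_iff] at h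
    rw [h] at hz
    exact hUB (e _).2 hz
  have hηstar := hη ⟨pstar, hpstar⟩ hBstar
  have hσ : relativeSingularHomology.map ℤ ℤ (subsetIncl U')
      (localHomology.mapsTo_subsetIncl_compl (e' ⟨pstar, hpstar'⟩).2) k
      ((η : ℤ) • localHomology.xEquiv ℤ ℤ e' ⟨pstar, hpstar'⟩ k
        ((localHomology.openSubsetIso ℤ ℤ hV'o hpstar' k).inv (g𝔼.localClass pstar))) =
      relativeSingularHomology.map ℤ ℤ (ContinuousMap.id _) (Tj.mapsTo_id_compl_of_eq_singleton h₀' hAj hF) k γ₀ := by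
    rw [map_zsmul, hE1]
    have h' := hηstar
    rw [map_zsmul] at h'
    exact h'.symm
  have hcrossj := Tj.functional_map_eq_smul_of_single g𝔼 hAj φ h₀' hUN' hV'o hpstar' e' hF
    (fun p => Kt (E p)) hf' hfd hLdet γ₀ (η : ℤ) hσ
  rw [hsgn, mul_neg] at hcrossj
  ----------------------------------------------------------------------------------------------
  -- Step 10: the top disc `O`, the open embedding `ι : O → D'`, the unit `ε`, and `Λᵢ(x')`
  ----------------------------------------------------------------------------------------------
  obtain ⟨hTop⟩ := S.exists_homeomorph_topDisc hc₀aL haL₁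
  letI : ChartedSpace (EuclideanSpace ℝ (Fin k))
      {y : c.W // y ∈ stableSet (𝓡∂ (n + 1)) (⇑ξ) (σ i) ∧ aL < S.g₁ y} :=
    hTop.toOpenPartialHomeomorph.singletonChartedSpace (Homeomorph.toOpenPartialHomeomorph_source _)
  have hOc : IsPreconnected (univ : Set {y : c.W // y ∈ stableSet (𝓡∂ (n + 1)) (⇑ξ) (σ i) ∧ aL < S.g₁ y}) := by
    rw [← hTop.symm.range_coe]
    exact isPreconnected_range hTop.symm.continuous
  have hιmem : ∀ o : {y : c.W // y ∈ stableSet (𝓡∂ (n + 1)) (⇑ξ) (σ i) ∧ aL < S.g₁ y},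
      (o : c.W) ∈ leftHandDisc (𝓡∂ (n + 1)) g' ξ₃ (σ i) t₀ := fun o =>
    (S.mem_leftHandDisc'_iff_of_lt hξ₃ hξ₃eq htrack hleft h12 hνt hIoo halt haL hc₀aL' o.2.2).2 o.2.1
  let ιO : C({y : c.W // y ∈ stableSet (𝓡∂ (n + 1)) (⇑ξ) (σ i) ∧ aL < S.g₁ y},
      ↥(leftHandDisc (𝓡∂ (n + 1)) g' ξ₃ (σ i) t₀)) :=
    ⟨fun o => ⟨(o : c.W), hιmem o⟩, continuous_subtype_val.subtype_mk _⟩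
  have hιemb : Topology.IsEmbedding ιO :=
    Topology.IsEmbedding.subtypeVal.codRestrict (leftHandDisc (𝓡∂ (n + 1)) g' ξ₃ (σ i) t₀) hιmem
  have hιrange : range ιO = {z : ↥(leftHandDisc (𝓡∂ (n + 1)) g' ξ₃ (σ i) t₀) | aL < S.g₁ (z : c.W)} := by
    ext z
    constructor
    · rintro ⟨o, rfl⟩
      exact o.2.2
    · intro hz
      exact ⟨⟨z.1, (S.mem_leftHandDisc'_iff_of_lt hξ₃ hξ₃eq htrack hleft h12 hνt hIoo halt haL hc₀aL' hz).1 z.2,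
        hz⟩, rfl⟩
  have hιopen : IsOpen (range ιO) := by
    rw [hιrange]
    exact isOpen_lt continuous_const (S.contMDiff_g₁.continuous.comp continuous_subtype_val)
  have hιOE : Topology.IsOpenEmbedding ιO := ⟨hιemb, hιopen⟩
  have hιB : ∀ o, ιO o ∈ (Subtype.val ⁻¹' leftHandSphere (𝓡∂ (n + 1)) g' ξ₃ (σ i) t₀)ᶜ := fun o h =>
    (S.lt_newFunction_of_c₀_lt hIoo halt (hc₀aL'.trans o.2.2)).ne' h.2
  have hgenO : ∀ o, ∃ f₀ : _ ≃ₗ[ℤ] ℤ, f₀ (relLocalFamily γ₀ (ιO o)) = 1 := fun o => by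
    obtain ⟨f₀, hf₀⟩ := Cobordism.isGenerator_localisation_leftHandDisc hg' ξ₃ hξg' S.ht₀ hpk htp hnoval γ₀ hγ₀
      (ιO o) (S.lt_newFunction_of_c₀_lt hIoo halt (hc₀aL'.trans o.2.2)).ne'
    exact ⟨f₀, by rw [relLocalFamily_apply _ (hιB o)]; exact hf₀⟩
  obtain ⟨ε, hε⟩ := exists_units_relLocalFamily_eq_smul_map hOc ιO hιOE hιB γ₀ μ hgenO
  -- the germ crossing at `σ i`
  let oᵢ : {y : c.W // y ∈ stableSet (𝓡∂ (n + 1)) (⇑ξ) (σ i) ∧ aL < S.g₁ y} :=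
    ⟨σ i, S.σi_mem_topDisc haL₁⟩
  have hFi : {t : ↥(leftHandDisc (𝓡∂ (n + 1)) g' ξ₃ (σ i) t₀) | φ t ∈ Ti.P} = {ιO oᵢ} := by
    ext t
    rw [mem_setOf_eq, mem_singleton_iff, hPi]
    constructor
    · intro ht
      exact Subtype.ext (S.eq_σi_of_mem_stableSet_of_mem_unstableSet hξ₃ t.2.1 ht)
    · intro ht
      rw [ht]
      exact self_mem_unstableSet (S.hξ₁.apply_eq_zero_of_isMCriticalPt (S.σ_mem_criticalSet₁ i))
  have hσi : relativeSingularHomology.map ℤ ℤ (ContinuousMap.id _)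
      (Ti.mapsTo_id_compl_of_eq_singleton h₀' hAi hFi) k γ₀ =
      relativeSingularHomology.map ℤ ℤ ιO (LocalFamily.mapsTo_compl_pt hιOE.injective oᵢ) k
        ((ε : ℤ) • μ.localClass oᵢ) := by
    have h1 := hε oᵢ
    rw [relLocalFamily_apply _ (hιB oᵢ)] at h1
    rw [map_zsmul]
    exact h1
  have hAi_val := Ti.functional_map_eq_of_toLocal_eq_map hAi φ h₀' hFi ιO hιOE.injective rfl γ₀
    ((ε : ℤ) • μ.localClass oᵢ) hσi
  simp only [map_zsmul] at hAi_val
  have hcompι : φ.comp ιO =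
      (⟨fun o : {y : c.W // y ∈ stableSet (𝓡∂ (n + 1)) (⇑ξ) (σ i) ∧ aL < S.g₁ y} =>
          (⟨(o : c.W), S.mem_slab_of_mem_topDisc hX hc₀aL o.2⟩ : ↥X),
        continuous_subtype_val.subtype_mk _⟩ : C(_, ↥X)) := by
    ext o; rfl
  have hmaps : MapsTo (fun o : {y : c.W // y ∈ stableSet (𝓡∂ (n + 1)) (⇑ξ) (σ i) ∧ aL < S.g₁ y} =>
        (⟨(o : c.W), S.mem_slab_of_mem_topDisc hX hc₀aL o.2⟩ : ↥X)) ({oᵢ}ᶜ : Set _) Ti.Pᶜ :=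
    fun o ho => TransverseDiscDatum.mapsTo_comp_compl_of_eq_singleton (φ := φ) hιOE.injective rfl hFi ho
  rw [relativeSingularHomology.map_congr ℤ ℤ hcompι _ hmaps k] at hAi_val
  ----------------------------------------------------------------------------------------------
  -- Step 11: the strip `𝒱`, its chart `ê` into `O`, and the comparison of `μ` with `ê⁎ g𝔼`
  ----------------------------------------------------------------------------------------------
  have h𝒱V : {p : EuclideanSpace ℝ (Fin k) | aL < (S.Lk.symm p).1 ∧ (S.Lk.symm p).1 < (aL + S.c₁) / 2} ⊆ Vk := by
    intro p hp
    refine (hVk p).2 ⟨⟨?_, ?_⟩, ?_⟩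
    · have := hp.1; linarith
    · have := hp.2; linarith
    · rw [S.χL_target]; trivial
  have h𝒱o : IsOpen {p : EuclideanSpace ℝ (Fin k) | aL < (S.Lk.symm p).1 ∧ (S.Lk.symm p).1 < (aL + S.c₁) / 2} :=
    S.isOpen_levelStrip aL ((aL + S.c₁) / 2)
  have hmem𝒱 : ∀ v : ↥{p : EuclideanSpace ℝ (Fin k) | aL < (S.Lk.symm p).1 ∧ (S.Lk.symm p).1 < (aL + S.c₁) / 2},
      E v ∈ stableSet (𝓡∂ (n + 1)) (⇑ξ) (σ i) ∧ aL < S.g₁ (E v) := fun v => by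
    have hv := h𝒱V v.2
    obtain ⟨hgv, -, -⟩ := hEp v.1 hv
    have ha : aL < S.g₁ (E v) := by rw [hgv]; exact v.2.1
    exact ⟨(S.mem_leftHandDisc'_iff_of_lt hξ₃ hξ₃eq htrack hleft h12 hνt hIoo halt haL hc₀aL' ha).1 (hE v.1 hv), ha⟩
  let Ψh : ↥{p : EuclideanSpace ℝ (Fin k) | aL < (S.Lk.symm p).1 ∧ (S.Lk.symm p).1 < (aL + S.c₁) / 2} →
      {y : c.W // y ∈ stableSet (𝓡∂ (n + 1)) (⇑ξ) (σ i) ∧ aL < S.g₁ y} := fun v => ⟨E v, hmem𝒱 v⟩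
  have hΨemb : Topology.IsEmbedding Ψh := by
    have h1 : Topology.IsEmbedding (ιO ∘ Ψh) := by
      have : (ιO ∘ Ψh) = ch ∘ Set.inclusion h𝒱V := rfl
      rw [this]
      exact hemb.comp (Topology.IsEmbedding.inclusion h𝒱V)
    exact hιemb.of_comp_iff.1 h1
  let W : Set {y : c.W // y ∈ stableSet (𝓡∂ (n + 1)) (⇑ξ) (σ i) ∧ aL < S.g₁ y} := range Ψh
  let ê : ↥{p : EuclideanSpace ℝ (Fin k) | aL < (S.Lk.symm p).1 ∧ (S.Lk.symm p).1 < (aL + S.c₁) / 2} ≃ₜ ↥W :=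
    hΨemb.toHomeomorph
  refine ⟨ε, η, hmaps, W, ê, fun v => ?_, hAi_val, hL₀det, hcrossj, fun c' => ?_⟩
  · -- the chart is the flow-up of the sheet
    show E v = _
    exact S.crossingChart_eq_levelProj_of_le ρ h12 hνt hEp hθ (h𝒱V v.2) (haL.trans (le_of_lt v.2.1))
  · -- `μ = (ε η) • ê⁎ g𝔼` along the strip
    have hc' : (c' : EuclideanSpace ℝ (Fin k)) ∈ Vk := h𝒱V c'.2
    have hB' : MapsTo (ContinuousMap.id ↥(leftHandDisc (𝓡∂ (n + 1)) g' ξ₃ (σ i) t₀))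
        (Subtype.val ⁻¹' leftHandSphere (𝓡∂ (n + 1)) g' ξ₃ (σ i) t₀)
        ({((e ⟨c', hc'⟩ : ↥U) : ↥(leftHandDisc (𝓡∂ (n + 1)) g' ξ₃ (σ i) t₀))}ᶜ : Set _) := by
      intro z hz h
      rw [ContinuousMap.id_apply, mem_singleton_iff] at h
      rw [h] at hz
      exact hUB (e _).2 hz
    have h2 := hη ⟨c', hc'⟩ hB'
    have h1 := hε (Ψh c')
    rw [relLocalFamily_apply _ (hιB _)] at h1
    have h3 : (ε : ℤ) • relativeSingularHomology.map ℤ ℤ ιO (LocalFamily.mapsTo_compl_pt hιOE.injective (Ψh c')) k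
        (μ.localClass (Ψh c')) =
        relativeSingularHomology.map ℤ ℤ (subsetIncl U) (localHomology.mapsTo_subsetIncl_compl (e ⟨c', hc'⟩).2) k
          ((η : ℤ) • localHomology.xEquiv ℤ ℤ e ⟨c', hc'⟩ k
            ((localHomology.openSubsetIso ℤ ℤ hVko hc' k).inv (g𝔼.localClass (c' : EuclideanSpace ℝ (Fin k))))) := by
      exact h1.symm.trans h2
    have hN := map_map_subsetIncl_xEquiv_eq hVko e ιO hιOE.injective h𝒱o h𝒱V ê (fun v => rfl) c'
      (g𝔼.localClass (c' : EuclideanSpace ℝ (Fin k)))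
    have hN' : relativeSingularHomology.map ℤ ℤ ιO (LocalFamily.mapsTo_compl_pt hιOE.injective (Ψh c')) k
        (relativeSingularHomology.map ℤ ℤ (subsetIncl W) (localHomology.mapsTo_subsetIncl_compl (ê c').2) k
          (localHomology.xEquiv ℤ ℤ ê c' k
            ((localHomology.openSubsetIso ℤ ℤ h𝒱o c'.2 k).inv (g𝔼.localClass (c' : EuclideanSpace ℝ (Fin k)))))) =
        relativeSingularHomology.map ℤ ℤ (subsetIncl U) (localHomology.mapsTo_subsetIncl_compl (e ⟨c', hc'⟩).2) k
          (localHomology.xEquiv ℤ ℤ e ⟨c', hc'⟩ k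
            ((localHomology.openSubsetIso ℤ ℤ hVko hc' k).inv (g𝔼.localClass (c' : EuclideanSpace ℝ (Fin k))))) := hN
    have h4 : relativeSingularHomology.map ℤ ℤ ιO (LocalFamily.mapsTo_compl_pt hιOE.injective (Ψh c')) k
        (μ.localClass (Ψh c')) =
        ((ε * η : ℤˣ) : ℤ) • relativeSingularHomology.map ℤ ℤ (subsetIncl U)
          (localHomology.mapsTo_subsetIncl_compl (e ⟨c', hc'⟩).2) k
          (localHomology.xEquiv ℤ ℤ e ⟨c', hc'⟩ k
            ((localHomology.openSubsetIso ℤ ℤ hVko hc' k).inv (g𝔼.localClass (c' : EuclideanSpace ℝ (Fin k))))) :=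
      eq_units_mul_smul_of_smul_eq ε η h3 (map_zsmul _ _ _)
    have hinjι : Function.Injective
        (relativeSingularHomology.map ℤ ℤ ιO (LocalFamily.mapsTo_compl_pt hιOE.injective (Ψh c')) k) := by
      haveI := localHomology.isIso_map_of_isOpenEmbedding_of_eq ℤ ℤ ιO hιOE (Ψh c') rfl k
      exact (ModuleCat.mono_iff_injective _).1 inferInstance
    have h7 : relativeSingularHomology.map ℤ ℤ ιO (LocalFamily.mapsTo_compl_pt hιOE.injective (Ψh c')) k
        (μ.localClass (Ψh c')) =
        relativeSingularHomology.map ℤ ℤ ιO (LocalFamily.mapsTo_compl_pt hιOE.injective (Ψh c')) k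
          (((ε * η : ℤˣ) : ℤ) • relativeSingularHomology.map ℤ ℤ (subsetIncl W)
            (localHomology.mapsTo_subsetIncl_compl (ê c').2) k
            (localHomology.xEquiv ℤ ℤ ê c' k
              ((localHomology.openSubsetIso ℤ ℤ h𝒱o c'.2 k).inv (g𝔼.localClass (c' : EuclideanSpace ℝ (Fin k)))))) :=
      h4.trans (((congrArg (fun x => ((ε * η : ℤˣ) : ℤ) • x) hN').symm).trans (map_zsmul _ _ _).symm)
    exact hinjι h7

end SlideSetting

end Literature.Topology.FourManifolds

end
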